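import Summits.MatrixMultiplication.MatrixMultiplication.Theorems.EdgePencilDanskin
import HarnessLib

/-!
# Maximising faces of `X₄`: Kronecker tightness is a meeting of faces; the classes where a common
# maximiser is PROVED (powers, units) and the one factor `[P_n]` that escapes them

Support kernel for `stmt-MatrixMultiplication-26697` (`TetraExcessZero : ω(K₄) ≤ ω(2,1,2) =: ψ`, route
`TetrahedronCarving`; cut of record `closes (TetraExcessZero) (TetraPlusTwo) : ω = 2`, UNCHANGED; lineage
`decomp-mm-lens-6`, generation 46; sequel of `EdgePencilBimaximal` / `EdgePencilDanskin`). No item is added or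
changed; no definition is introduced. Notation as there: `X_d(K) = DTensorClass.asymptoticSpectrumDTensors K d'`
(`d = d' + 2`), `R̃ = asympRankOf (· ≤ ·)`, `X₄(F)` (`d' = 2`), `[t] = DTensorClass.mk t`, `W_n^{(e)} = sixTetra F n e`,
`D_n = W_n^{(1)}`, `T(K₄)_n = tetra F n`, `P_e = (i ↦ [i 0 = i 1])` on `Fin 4 → Fin e`, `χ(δ) = omegaSix F δ`,
`ψ = ω(2,1,2)`, `T = ω(K₄)`, `p_φ = log₂ φ[P_2]` (sight), `d_φ = log₂ φ[D_2]` (diamond rate). Everything inline.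

The MAXIMISING FACE of `x ∈ T_d(K)` is the set `F(x) := X_d ∩ {φ | φ x = R̃ x}` (spelled out in every statement).

§37 FACES AND KRONECKER TIGHTNESS (generic `d`-tensors over any field): `F(x)` is non-empty and compact
(`maxFace_nonempty`, `isCompact_maxFace`: `R̃ = max_φ φ` on the compact `X_d`); `R̃(xy) ≤ R̃(x)R̃(y)`
(`asympRank_mul_le`); for `x, y ≠ 0`, **`R̃(xy) = R̃(x)R̃(y)` iff the faces MEET, `F(x) ∩ F(y) ≠ ∅`**
(`asympRank_mul_eq_iff_maxFaces_meet`); the classes with a PROVED common maximiser: POWERS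
(`asympRank_pow_eq : R̃(x^k) = R̃(x)^k`, `spectrum_pow_eq_asympRank_iff : F(x^k) = F(x)`,
`asympRank_mul_pow_eq : R̃(x·x^k) = R̃(x)·R̃(x^k)` — Kronecker squares are tight) and UNITS
(`spectrum_natCast_mul_eq_asympRank_iff : F(n·x) = F(x)`, `asympRank_natCast_mul_eq : R̃(n·x) = n·R̃(x)`,
`asympRank_mul_natCast_mul_eq : R̃(x·(n·y)) = n·R̃(x·y)`).

§38 THE TWO FACES OF THE PENCIL (`X₄(F)`): the faces of `[D_n]` and `[T(K₄)_n]` are BASE-FREE — membership is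
`d_φ = ψ`, resp. `p_φ + d_φ = T`, for every `n ≥ 2` (`spectrum_diamond_eq_asympRank_iff`,
`spectrum_tetra_eq_asympRank_iff`); **`MidTight ⟺ F[D_n] ∩ F[T(K₄)_n] ≠ ∅`** (`midTight_iff_maxFaces_meet`, the
typed first lemma of the common-maximiser attack on `stub_midTight`); since `[T(K₄)_n] = [P_n]·[D_n]`
(`mk_tetra_eq_pair_mul_diamond`), `MidTight ⟺ R̃([D_n]·([P_n]·[D_n])) = R̃[D_n]·R̃([P_n]·[D_n])`
(`midTight_iff_asympRank_diamond_mul_pair_mul_diamond`; the generic criterion applied to `[D_n], [T(K₄)_n] ≠ 0`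
(`mk_diamond_ne_zero`, `mk_tetra_ne_zero`) is `EdgePencilBimaximal.midTight_iff_asympRank_mul_eq`): against
the proved classes of §37 (second factor a power of the first, or a unit multiple), the content of `MidTight` is
exactly the one non-unit, non-power factor `[P_n]` (the EPR pair on the missing edge; `1 ≤ φ[P_2] ≤ 2` with
sight `p_φ ∈ [0,1]`).

BY NAME over `ℂ`: `TetraExcessZero ⟺ DMaxBlind ∧ (F[D_n] ∩ F[T(K₄)_n] ≠ ∅)`
(`tetraExcessZero_iff_dMaxBlind_and_maxFaces_meet`); NEC `maxFaces_meet_of_matrixMultiplication`. The extremal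
sights on the two faces (max on `F[D_2]`, min on `F[T(K₄)_2]`) are the sequel `EdgePencilExtremalSights`.

References: Strassen 1988, Thm. 3.8 [Strassen1988]; Zuiddam 2018, Thm. 2.12, Cor. 2.13, Thm. 2.15 [Zuiddam2018];
Christandl–Vrana–Zuiddam 2023, Thm. 1.1, Prop. 1.6 [ChristandlVranaZuiddam2023]; Christandl–Vrana–Zuiddam,
arXiv:1609.07476, §1.1 [ChristandlVranaZuiddam2016]; Lotti–Romani 1983, §2 [LottiRomani1983]. No `sorry`, no
new axiom, no instance, no notation, no definition.
-/

noncomputable section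

set_option linter.dupNamespace false

open Filter Finset Literature.Computability.AlgebraicComplexity
open Summit.MatrixMultiplication.MatrixMultiplication.Theorems.TetrahedronTensor
open Summit.MatrixMultiplication.MatrixMultiplication.Theorems.TetraDiagonal
open Summit.MatrixMultiplication.MatrixMultiplication.Theses.TetrahedronCarving

namespace Summit.MatrixMultiplication.MatrixMultiplication.Theorems.EdgePencil

/-! ## §37 Maximising faces and Kronecker tightness in `X_d(K)` (generic `d`-tensors) -/

section Faces

variable {K : Type} [Field K] {d' : ℕ}

/-- **The maximising face `F(x) = X_d ∩ {φ | φ x = R̃ x}` is non-empty** (`R̃ = max_φ φ`, attained).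
[cite: ChristandlVranaZuiddam2023, Prop. 1.6] -/
theorem maxFace_nonempty (x : DTensorClass K (d' + 2)) :
    (DTensorClass.asymptoticSpectrumDTensors K d' ∩
      {φ | φ x = asympRankOf (fun x y : DTensorClass K (d' + 2) => x ≤ y) x}).Nonempty := by
  obtain ⟨φ, hφ, h⟩ := DTensorClass.exists_mem_spectrum_apply_eq_asympRankOf x
  exact ⟨φ, hφ, h⟩

/-- **The maximising face is compact** (a closed condition on one continuous coordinate of the compact `X_d`).
[cite: Zuiddam2018, Thm. 2.15] -/
theorem isCompact_maxFace (x : DTensorClass K (d' + 2)) :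
    IsCompact (DTensorClass.asymptoticSpectrumDTensors K d' ∩
      {φ | φ x = asympRankOf (fun x y : DTensorClass K (d' + 2) => x ≤ y) x}) :=
  DTensorClass.isCompact_asymptoticSpectrumDTensors.inter_right
    (isClosed_eq (continuous_apply x) continuous_const)

/-- `0 < φ x` for `x ≠ 0` (`x ≥ 1`, `φ 1 = 1`). [cite: Zuiddam2018, Def. 2.8] -/
theorem spectrum_pos_of_ne_zero {x : DTensorClass K (d' + 2)} (hx : x ≠ 0) {φ : DTensorClass K (d' + 2) → ℝ}
    (hφ : φ ∈ DTensorClass.asymptoticSpectrumDTensors K d') : 0 < φ x := by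
  have hφ' := DTensorClass.mem_asymptoticSpectrumDTensors_iff.1 hφ
  have h := hφ'.mono (DTensorClass.one_le_of_ne_zero hx)
  rw [hφ'.map_one] at h
  exact one_pos.trans_le h

/-- `0 ≤ φ x`. [cite: Zuiddam2018, Def. 2.8] -/
theorem spectrum_nonneg (x : DTensorClass K (d' + 2)) {φ : DTensorClass K (d' + 2) → ℝ}
    (hφ : φ ∈ DTensorClass.asymptoticSpectrumDTensors K d') : 0 ≤ φ x :=
  (DTensorClass.mem_asymptoticSpectrumDTensors_iff.1 hφ).nonneg (DTensorClass.isStrassenPreorder K d') x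

/-- **Sub-multiplicativity**: `R̃(xy) ≤ R̃(x)·R̃(y)` (evaluate a maximiser of `xy`).
[cite: ChristandlVranaZuiddam2023, Prop. 1.6] -/
theorem asympRank_mul_le (x y : DTensorClass K (d' + 2)) :
    asympRankOf (fun x y : DTensorClass K (d' + 2) => x ≤ y) (x * y) ≤
      asympRankOf (fun x y : DTensorClass K (d' + 2) => x ≤ y) x *
        asympRankOf (fun x y : DTensorClass K (d' + 2) => x ≤ y) y := by
  obtain ⟨φ, hφ, hφeq⟩ := DTensorClass.exists_mem_spectrum_apply_eq_asympRankOf (x * y)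
  rw [← hφeq, (DTensorClass.mem_asymptoticSpectrumDTensors_iff.1 hφ).map_mul]
  exact mul_le_mul (DTensorClass.le_asympRankOf hφ x) (DTensorClass.le_asympRankOf hφ y)
    (spectrum_nonneg y hφ) (IsStrassenPreorder.asympRankOf_nonneg _ x)

/-- **KRONECKER TIGHTNESS IS A MEETING OF FACES**: for `x, y ≠ 0`, `R̃(xy) = R̃(x)·R̃(y)` iff some spectral point
is maximal on `x` AND on `y` (`F(x) ∩ F(y) ≠ ∅`): a maximiser of `xy` attaining the product bound must attain both
factors, since both values are positive. [cite: ChristandlVranaZuiddam2023, Prop. 1.6] -/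
theorem asympRank_mul_eq_iff_maxFaces_meet {x y : DTensorClass K (d' + 2)} (hx : x ≠ 0) (hy : y ≠ 0) :
    asympRankOf (fun x y : DTensorClass K (d' + 2) => x ≤ y) (x * y) =
        asympRankOf (fun x y : DTensorClass K (d' + 2) => x ≤ y) x *
          asympRankOf (fun x y : DTensorClass K (d' + 2) => x ≤ y) y ↔
      (DTensorClass.asymptoticSpectrumDTensors K d' ∩
          {φ | φ x = asympRankOf (fun x y : DTensorClass K (d' + 2) => x ≤ y) x} ∩
        {φ | φ y = asympRankOf (fun x y : DTensorClass K (d' + 2) => x ≤ y) y}).Nonempty := by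
  constructor
  · intro h
    obtain ⟨φ, hφ, hφeq⟩ := DTensorClass.exists_mem_spectrum_apply_eq_asympRankOf (x * y)
    rw [h, (DTensorClass.mem_asymptoticSpectrumDTensors_iff.1 hφ).map_mul] at hφeq
    have hxle := DTensorClass.le_asympRankOf hφ x
    have hyle := DTensorClass.le_asympRankOf hφ y
    have hxpos := spectrum_pos_of_ne_zero hx hφ
    have hypos := spectrum_pos_of_ne_zero hy hφ
    refine ⟨φ, ⟨hφ, ?_⟩, ?_⟩
    · show φ x = _
      by_contra hne
      have hlt := lt_of_le_of_ne hxle hne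
      have : φ x * φ y < asympRankOf (fun x y : DTensorClass K (d' + 2) => x ≤ y) x *
          asympRankOf (fun x y : DTensorClass K (d' + 2) => x ≤ y) y :=
        calc φ x * φ y < asympRankOf (fun x y : DTensorClass K (d' + 2) => x ≤ y) x * φ y :=
              mul_lt_mul_of_pos_right hlt hypos
          _ ≤ _ := mul_le_mul_of_nonneg_left hyle (hxpos.le.trans hxle)
      linarith
    · show φ y = _
      by_contra hne
      have hlt := lt_of_le_of_ne hyle hne
      have : φ x * φ y < asympRankOf (fun x y : DTensorClass K (d' + 2) => x ≤ y) x *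
          asympRankOf (fun x y : DTensorClass K (d' + 2) => x ≤ y) y :=
        calc φ x * φ y < φ x * asympRankOf (fun x y : DTensorClass K (d' + 2) => x ≤ y) y :=
              mul_lt_mul_of_pos_left hlt hxpos
          _ ≤ _ := mul_le_mul_of_nonneg_right hxle (hypos.le.trans hyle)
      linarith
  · rintro ⟨φ, ⟨hφ, hxeq⟩, hyeq⟩
    refine le_antisymm (asympRank_mul_le x y) ?_
    have hxeq' : φ x = asympRankOf (fun x y : DTensorClass K (d' + 2) => x ≤ y) x := hxeq
    have hyeq' : φ y = asympRankOf (fun x y : DTensorClass K (d' + 2) => x ≤ y) y := hyeq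
    rw [← hxeq', ← hyeq', ← (DTensorClass.mem_asymptoticSpectrumDTensors_iff.1 hφ).map_mul]
    exact DTensorClass.le_asympRankOf hφ _

/-- **POWERS ARE TIGHT**: `R̃(x^k) = R̃(x)^k` (a maximiser of `x` maximises every power; conversely
`φ(x)^k ≤ R̃(x)^k`). The `≥` half is the tree's abstract `IsStrassenPreorder.pow_asympRankOf_le`.
[cite: Zuiddam2018, Cor. 2.13] -/
theorem asympRank_pow_eq (x : DTensorClass K (d' + 2)) (k : ℕ) :
    asympRankOf (fun x y : DTensorClass K (d' + 2) => x ≤ y) (x ^ k) =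
      asympRankOf (fun x y : DTensorClass K (d' + 2) => x ≤ y) x ^ k := by
  refine le_antisymm ?_ ?_
  · obtain ⟨φ, hφ, hφeq⟩ := DTensorClass.exists_mem_spectrum_apply_eq_asympRankOf (x ^ k)
    rw [← hφeq, (DTensorClass.mem_asymptoticSpectrumDTensors_iff.1 hφ).map_pow]
    exact pow_le_pow_left₀ (spectrum_nonneg x hφ) (DTensorClass.le_asympRankOf hφ x) k
  · obtain ⟨φ, hφ, hφeq⟩ := DTensorClass.exists_mem_spectrum_apply_eq_asympRankOf x
    rw [← hφeq, ← (DTensorClass.mem_asymptoticSpectrumDTensors_iff.1 hφ).map_pow]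
    exact DTensorClass.le_asympRankOf hφ _

/-- **The face of a power is the face**: `φ(x^k) = R̃(x^k) ⟺ φ(x) = R̃(x)` (`x ≠ 0`, `k ≥ 1`).
[cite: Zuiddam2018, Cor. 2.13] -/
theorem spectrum_pow_eq_asympRank_iff {x : DTensorClass K (d' + 2)} (hx : x ≠ 0) {k : ℕ} (hk : 1 ≤ k)
    {φ : DTensorClass K (d' + 2) → ℝ} (hφ : φ ∈ DTensorClass.asymptoticSpectrumDTensors K d') :
    φ (x ^ k) = asympRankOf (fun x y : DTensorClass K (d' + 2) => x ≤ y) (x ^ k) ↔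
      φ x = asympRankOf (fun x y : DTensorClass K (d' + 2) => x ≤ y) x := by
  rw [asympRank_pow_eq, (DTensorClass.mem_asymptoticSpectrumDTensors_iff.1 hφ).map_pow]
  exact pow_left_inj₀ (spectrum_nonneg x hφ) ((spectrum_pos_of_ne_zero hx hφ).le.trans
    (DTensorClass.le_asympRankOf hφ x)) (by omega)

/-- **KRONECKER SQUARES (and `x·x^k`) ARE TIGHT**: `R̃(x·x^k) = R̃(x)·R̃(x^k)` — the class of pairs
`(x, x^k)` has a PROVED common maximiser. [cite: Zuiddam2018, Cor. 2.13] -/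
theorem asympRank_mul_pow_eq (x : DTensorClass K (d' + 2)) (k : ℕ) :
    asympRankOf (fun x y : DTensorClass K (d' + 2) => x ≤ y) (x * x ^ k) =
      asympRankOf (fun x y : DTensorClass K (d' + 2) => x ≤ y) x *
        asympRankOf (fun x y : DTensorClass K (d' + 2) => x ≤ y) (x ^ k) := by
  rw [← pow_succ', asympRank_pow_eq, asympRank_pow_eq, pow_succ']

/-- `φ(n·x) = n·φ(x)`. [cite: Zuiddam2018, Def. 2.8] -/
theorem spectrum_natCast_mul (n : ℕ) (x : DTensorClass K (d' + 2)) {φ : DTensorClass K (d' + 2) → ℝ}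
    (hφ : φ ∈ DTensorClass.asymptoticSpectrumDTensors K d') : φ ((n : DTensorClass K (d' + 2)) * x) = n * φ x := by
  have hφ' := DTensorClass.mem_asymptoticSpectrumDTensors_iff.1 hφ
  rw [hφ'.map_mul, hφ'.map_natCast]

/-- **UNITS ARE TIGHT**: `R̃(n·x) = n·R̃(x)` (every spectral point takes the value `n` at the unit `n`).
The `≤` half is the tree's abstract `IsStrassenPreorder.asympRankOf_natCast_mul_le`. [cite: Zuiddam2018, Cor. 2.13] -/
theorem asympRank_natCast_mul_eq (n : ℕ) (x : DTensorClass K (d' + 2)) :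
    asympRankOf (fun x y : DTensorClass K (d' + 2) => x ≤ y) ((n : DTensorClass K (d' + 2)) * x) =
      n * asympRankOf (fun x y : DTensorClass K (d' + 2) => x ≤ y) x := by
  refine le_antisymm ((DTensorClass.isStrassenPreorder K d').asympRankOf_natCast_mul_le n x) ?_
  obtain ⟨φ, hφ, hφeq⟩ := DTensorClass.exists_mem_spectrum_apply_eq_asympRankOf x
  rw [← hφeq, ← spectrum_natCast_mul n x hφ]
  exact DTensorClass.le_asympRankOf hφ _

/-- **The face of a unit multiple is the face**: `φ(n·x) = R̃(n·x) ⟺ φ(x) = R̃(x)` (`n ≥ 1`).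
[cite: Zuiddam2018, Cor. 2.13] -/
theorem spectrum_natCast_mul_eq_asympRank_iff {n : ℕ} (hn : 1 ≤ n) (x : DTensorClass K (d' + 2))
    {φ : DTensorClass K (d' + 2) → ℝ} (hφ : φ ∈ DTensorClass.asymptoticSpectrumDTensors K d') :
    φ ((n : DTensorClass K (d' + 2)) * x) =
        asympRankOf (fun x y : DTensorClass K (d' + 2) => x ≤ y) ((n : DTensorClass K (d' + 2)) * x) ↔
      φ x = asympRankOf (fun x y : DTensorClass K (d' + 2) => x ≤ y) x := by
  have hn0 : (0 : ℝ) < n := by exact_mod_cast hn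
  rw [asympRank_natCast_mul_eq, spectrum_natCast_mul n x hφ]
  exact ⟨fun h => mul_left_cancel₀ hn0.ne' h, fun h => by rw [h]⟩

/-- **A unit on one side never breaks tightness**: `R̃(x·(n·y)) = n·R̃(x·y)`; in particular the pair
`(x, n·x)` is tight, `R̃(x·(n·x)) = R̃(x)·R̃(n·x)`. [cite: Zuiddam2018, Cor. 2.13] -/
theorem asympRank_mul_natCast_mul_eq (n : ℕ) (x y : DTensorClass K (d' + 2)) :
    asympRankOf (fun x y : DTensorClass K (d' + 2) => x ≤ y) (x * ((n : DTensorClass K (d' + 2)) * y)) =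
      n * asympRankOf (fun x y : DTensorClass K (d' + 2) => x ≤ y) (x * y) := by
  rw [mul_left_comm, asympRank_natCast_mul_eq]

/-- The pair `(x, n·x)` is tight: `R̃(x·(n·x)) = R̃(x)·R̃(n·x)`. [cite: Zuiddam2018, Cor. 2.13] -/
theorem asympRank_mul_natCast_mul_self_eq (n : ℕ) (x : DTensorClass K (d' + 2)) :
    asympRankOf (fun x y : DTensorClass K (d' + 2) => x ≤ y) (x * ((n : DTensorClass K (d' + 2)) * x)) =
      asympRankOf (fun x y : DTensorClass K (d' + 2) => x ≤ y) x *
        asympRankOf (fun x y : DTensorClass K (d' + 2) => x ≤ y) ((n : DTensorClass K (d' + 2)) * x) := by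
  rw [asympRank_mul_natCast_mul_eq, asympRank_natCast_mul_eq, ← pow_two, asympRank_pow_eq]
  ring

end Faces

/-! ## §38 The two faces of the pencil: base-free membership; `MidTight ⟺` the faces meet; the factor `[P_n]` -/

section Pencil

variable (F : Type) [Field F]

/-- **The diamond face is base-free**: `φ[D_n] = R̃[D_n] ⟺ d_φ = ψ` (`n ≥ 2`; `φ[D_n] = n^{d_φ}`, `R̃[D_n] = n^ψ`).
[cite: Strassen1988, Thm. 3.8] -/
theorem spectrum_diamond_eq_asympRank_iff {n : ℕ} (hn : 2 ≤ n) {φ : DTensorClass F 4 → ℝ}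
    (hφ : φ ∈ DTensorClass.asymptoticSpectrumDTensors F 2) :
    φ (DTensorClass.mk (sixTetra F n 1)) =
        asympRankOf (fun x y : DTensorClass F 4 => x ≤ y) (DTensorClass.mk (sixTetra F n 1)) ↔
      Real.logb 2 (φ (DTensorClass.mk (sixTetra F 2 1))) = omegaRect F 2 1 2 := by
  have hn1' : (1 : ℝ) < n := by exact_mod_cast (show 1 < n by omega)
  rw [spectrum_diamond_eq_rpow hφ (by omega : 1 ≤ n), ← rpow_omegaRect_eq_asympRank_diamond F hn,
    rpow_eq_rpow_iff_of_one_lt hn1']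

/-- **The tetrahedron face is base-free**: `φ[T(K₄)_n] = R̃[T(K₄)_n] ⟺ p_φ + d_φ = T` (`n ≥ 2`).
[cite: Strassen1988, Thm. 3.8] -/
theorem spectrum_tetra_eq_asympRank_iff {n : ℕ} (hn : 2 ≤ n) {φ : DTensorClass F 4 → ℝ}
    (hφ : φ ∈ DTensorClass.asymptoticSpectrumDTensors F 2) :
    φ (DTensorClass.mk (tetra F n)) =
        asympRankOf (fun x y : DTensorClass F 4 => x ≤ y) (DTensorClass.mk (tetra F n)) ↔
      Real.logb 2 (φ (DTensorClass.mk (fun i : Fin 4 → Fin 2 => (ind (i 0 = i 1) : F)))) +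
          Real.logb 2 (φ (DTensorClass.mk (sixTetra F 2 1))) = omegaTetra F := by
  have hn1' : (1 : ℝ) < n := by exact_mod_cast (show 1 < n by omega)
  rw [spectrum_tetra_eq_rpow hφ (by omega : 1 ≤ n), logb_spectrum_tetra_two hφ,
    ← rpow_omegaTetra_eq_asympRank F hn, rpow_eq_rpow_iff_of_one_lt hn1']

/-- **`MidTight ⟺ THE FACES MEET`**: `ψ + T ≤ 2χ(1/2)` iff `F[D_n] ∩ F[T(K₄)_n] ≠ ∅` in `X₄(F)` (`n ≥ 2`) — the
typed first lemma of the common-maximiser attack. [cite: ChristandlVranaZuiddam2023, Prop. 1.6] -/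
theorem midTight_iff_maxFaces_meet {n : ℕ} (hn : 2 ≤ n) :
    omegaRect F 2 1 2 + omegaTetra F ≤ 2 * omegaSix F (1 / 2) ↔
      (DTensorClass.asymptoticSpectrumDTensors F 2 ∩
          {φ | φ (DTensorClass.mk (sixTetra F n 1)) =
            asympRankOf (fun x y : DTensorClass F 4 => x ≤ y) (DTensorClass.mk (sixTetra F n 1))} ∩
        {φ | φ (DTensorClass.mk (tetra F n)) =
          asympRankOf (fun x y : DTensorClass F 4 => x ≤ y) (DTensorClass.mk (tetra F n))}).Nonempty := by
  rw [midTight_iff_exists_bimaximal_asympRank F hn]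
  simp only [Set.Nonempty, Set.mem_inter_iff, Set.mem_setOf_eq, and_assoc]

/-- **`[T(K₄)_n] = [P_n]·[D_n]`**: the tetrahedron is the diamond times the EPR pair on the missing edge.
[cite: ChristandlVranaZuiddam2016, §1.1] -/
theorem mk_tetra_eq_pair_mul_diamond {n : ℕ} (hn : 1 ≤ n) :
    DTensorClass.mk (tetra F n) =
      DTensorClass.mk (fun a : Fin 4 → Fin n => (ind (a 0 = a 1) : F)) * DTensorClass.mk (sixTetra F n 1) := by
  rw [← sixTetra_of_le (le_refl n), mk_sixTetra_eq_pair_mul_diamond (F := F) hn le_rfl]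

/-- `[D_n] ≠ 0` (`n ≥ 1`). [cite: ChristandlVranaZuiddam2016, §1.1] -/
theorem mk_diamond_ne_zero {n : ℕ} (hn : 1 ≤ n) : DTensorClass.mk (sixTetra F n 1) ≠ 0 := by
  intro h
  obtain ⟨φ, hφ⟩ := (DTensorClass.asymptoticSpectrumDTensors_nonempty (K := F) (d' := 2))
  have h1 := one_le_spectrum_sixTetra (F := F) hn le_rfl hφ
  rw [h, (DTensorClass.mem_asymptoticSpectrumDTensors_iff.1 hφ).map_zero] at h1
  exact absurd h1 (by norm_num)

/-- `[T(K₄)_n] ≠ 0` (`n ≥ 1`). [cite: ChristandlVranaZuiddam2016, §1.1] -/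
theorem mk_tetra_ne_zero {n : ℕ} (hn : 1 ≤ n) : DTensorClass.mk (tetra F n) ≠ 0 := by
  rw [← sixTetra_of_le (le_refl n)]
  intro h
  obtain ⟨φ, hφ⟩ := (DTensorClass.asymptoticSpectrumDTensors_nonempty (K := F) (d' := 2))
  have h1 := one_le_spectrum_sixTetra (F := F) hn hn hφ
  rw [h, (DTensorClass.mem_asymptoticSpectrumDTensors_iff.1 hφ).map_zero] at h1
  exact absurd h1 (by norm_num)

/-- **THE CONTENT OF `MidTight` IS THE FACTOR `[P_n]`**: `MidTight ⟺ R̃([D_n]·([P_n]·[D_n])) =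
R̃[D_n]·R̃([P_n]·[D_n])` (`n ≥ 2`). With `[P_n]` replaced by a unit `m` or by a power of `[D_n]` the identity
is a theorem (`asympRank_mul_natCast_mul_self_eq`, `asympRank_mul_pow_eq`). [cite: ChristandlVranaZuiddam2023, Prop. 1.6] -/
theorem midTight_iff_asympRank_diamond_mul_pair_mul_diamond {n : ℕ} (hn : 2 ≤ n) :
    omegaRect F 2 1 2 + omegaTetra F ≤ 2 * omegaSix F (1 / 2) ↔
      asympRankOf (fun x y : DTensorClass F 4 => x ≤ y)
          (DTensorClass.mk (sixTetra F n 1) *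
            (DTensorClass.mk (fun a : Fin 4 → Fin n => (ind (a 0 = a 1) : F)) * DTensorClass.mk (sixTetra F n 1))) =
        asympRankOf (fun x y : DTensorClass F 4 => x ≤ y) (DTensorClass.mk (sixTetra F n 1)) *
          asympRankOf (fun x y : DTensorClass F 4 => x ≤ y)
            (DTensorClass.mk (fun a : Fin 4 → Fin n => (ind (a 0 = a 1) : F)) * DTensorClass.mk (sixTetra F n 1)) := by
  rw [← mk_tetra_eq_pair_mul_diamond F (by omega : 1 ≤ n), midTight_iff_asympRank_mul_eq F hn]

end Pencil

/-! ## By name over `ℂ` -/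

/-- **BY NAME**: `TetraExcessZero ⟺ DMaxBlind ∧ (the faces of [D_n] and [T(K₄)_n] meet)` (`n ≥ 2`).
[cite: LottiRomani1983, §2 (p. 174)] -/
theorem tetraExcessZero_iff_dMaxBlind_and_maxFaces_meet {n : ℕ} (hn : 2 ≤ n) :
    TetraExcessZero ↔
      (∀ φ ∈ DTensorClass.asymptoticSpectrumDTensors ℂ 2,
        Real.logb 2 (φ (DTensorClass.mk (sixTetra ℂ 2 1))) = omegaRect ℂ 2 1 2 →
          Real.logb 2 (φ (DTensorClass.mk (fun i : Fin 4 → Fin 2 => (ind (i 0 = i 1) : ℂ)))) = 0) ∧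
        (DTensorClass.asymptoticSpectrumDTensors ℂ 2 ∩
            {φ | φ (DTensorClass.mk (sixTetra ℂ n 1)) =
              asympRankOf (fun x y : DTensorClass ℂ 4 => x ≤ y) (DTensorClass.mk (sixTetra ℂ n 1))} ∩
          {φ | φ (DTensorClass.mk (tetra ℂ n)) =
            asympRankOf (fun x y : DTensorClass ℂ 4 => x ≤ y) (DTensorClass.mk (tetra ℂ n))}).Nonempty := by
  rw [tetraExcessZero_iff_dMaxBlind_and_midTight, midTight_iff_maxFaces_meet ℂ hn]

/-- **NEC**: `ω = 2 ⟹` the faces of `[D_n]` and `[T(K₄)_n]` meet in `X₄(ℂ)` (`n ≥ 2`).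
[cite: Strassen1988, Thm. 3.8] -/
theorem maxFaces_meet_of_matrixMultiplication (hS : _root_.MatrixMultiplication) {n : ℕ} (hn : 2 ≤ n) :
    (DTensorClass.asymptoticSpectrumDTensors ℂ 2 ∩
        {φ | φ (DTensorClass.mk (sixTetra ℂ n 1)) =
          asympRankOf (fun x y : DTensorClass ℂ 4 => x ≤ y) (DTensorClass.mk (sixTetra ℂ n 1))} ∩
      {φ | φ (DTensorClass.mk (tetra ℂ n)) =
        asympRankOf (fun x y : DTensorClass ℂ 4 => x ≤ y) (DTensorClass.mk (tetra ℂ n))}).Nonempty :=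
  ((tetraExcessZero_iff_dMaxBlind_and_maxFaces_meet hn).1 (excessZero_of_matrixMultiplication hS)).2

end Summit.MatrixMultiplication.MatrixMultiplication.Theorems.EdgePencil

end
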